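import Mathlib.Analysis.Calculus.FDeriv.Analytic
import Mathlib.Analysis.Normed.Module.FiniteDimension
import Mathlib.Topology.Connected.Basic
import Mathlib.Data.Set.Card
import HarnessLib

/-!
# Finiteness of connected components of analytic sign sets, uniform bounds in analytic families,
# and finiteness of critical values of real-analytic functions on compacts
# (Bierstone–Milman 1988, Cor. 2.7 (2) and Thm. 3.14; Souček–Souček 1972, Thm. 1)

Geometry/Semianalytic statement file — DRAFT prepared by the Navier–Stokes cell custodian (ns-idea-14 g12,
2026-08-29) for a Literature TYPER (director-ns key; pattern KEY-NS #194 «ONE named Literature fact per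
printed theorem»): THREE named facts, NO notions, no `sorry`.  They are VERBATIM INSTANCES of the printed
theorems over Mathlib notions only (zero / sign sets of functions analytic on an open set,
`connectedComponentIn`, `fderiv`) — no semianalytic / subanalytic / o-minimal infrastructure is introduced.
Consumer: `Summits/NavierStokesRegularity/…/Cruxes/PoloidalLiouville/IndicatrixSketch.lean` v1.5 §F (the
Λ-geo stubs are M-Lean bridges from exactly these three statements).  Nothing here refers to Navier–Stokes.
Suggested tree path: `Literature/Geometry/Semianalytic/AnalyticSignSetFiniteness.lean`.

**Sources.**  [BM88] E. Bierstone, P. D. Milman, *Semianalytic and subanalytic sets*, Publ. Math. IHÉS 67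
(1988) 5–42, doi:10.1007/bf02699126 (bib key `BierstoneMilman1988`, in references.bib; held text: lit key
`paper:bierstone1988-semianalytic-subanalytic-sets`).  Def. 2.1 (p. 10): "A subset `X` of `M` is semianalytic if each
`a ∈ M` has a neighbourhood `U` such that `X ∩ U ∈ S(𝒪(U))`" (finite unions of sets
`{f₁ = 0, …, f_k = 0, g₁ > 0, …, g_l > 0}` with `fᵢ, gⱼ` real-analytic on `U`; `M` a real-analytic manifold).
**Corollary 2.7** (p. 13): "Let `X` be a semianalytic subset of `M`. Then: (1) Every connected component of
`X` is semianalytic. (2) The family of connected components of `X` is locally finite (in particular, finite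
if `X` is relatively compact). (3) `X` is locally connected."  Def. 3.1 / 3.2 (p. 16): subanalytic sets;
a mapping `φ : X → N` is subanalytic if its graph is subanalytic in `M × N`.  **Theorem 3.14** (p. 21):
"Let `M` and `N` be real analytic manifolds, and let `X` be a relatively compact subset of `M`. Let
`φ : X → N` be a subanalytic mapping. Then the number of connected components of a fiber `φ⁻¹(y)` is
bounded locally on `N`."
[SS72] J. Souček, V. Souček, *Morse–Sard theorem for real-analytic functions*, Comment. Math. Univ.
Carolinae 13 (1972) 45–51 (DML-CZ record https://dml.cz/dmlcz/105394, title verified 2026-08-29; held text: lit key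
`paper:w2726589632`; bib key `SoucekSoucek1972` — NOTE: the references.bib entry added 2026-08-29 carries the WRONG
record id 105393 in its `url` field; typer/operator please correct to 105394).  **Theorem 1** (p. 45): "Let `f` be a real-analytic function defined on an open
subset `D ⊂ E_N`.  Let us denote by `Z` the set of critical points of `f`, i.e.
`Z = {x ∈ D : ∂f/∂xᵢ (x) = 0, i = 1, …, N}`; then the set `f(Z ∩ K)` is finite for every compact subset
`K ⊂ D` and hence `f(Z)` is at most countable."

**Why the typed statements are instances.**  (F1) For `h, g` real-analytic on the open set `U` of a
finite-dimensional real normed space (`U` is a real-analytic manifold), `X₀ := {x ∈ U : h x = 0 ∧ g x = 0}`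
and `X₊ := {x ∈ U : h x = 0 ∧ g x ≠ 0} = {h = 0, g > 0} ∪ {h = 0, −g > 0}` are semianalytic in `U`
(Def. 2.1, described globally), and relatively compact in `U` when `{x ∈ U : h x = 0}` is compact;
Cor. 2.7 (2) gives finitely many connected components.  (F2) For `H, G` real-analytic on `P × U`
(`P ⊆ ℝᵐ`, `U` open) and a closed box `Icc a b ⊆ P`, the set
`X := {(p, x) ∈ P × U : p ∈ Icc a b ∧ H (p, x) = 0 ∧ G (p, x) = 0}` (resp. `≠ 0`) is semianalytic in
`M := P × U` (the box contributes `2m` affine sign conditions) and relatively compact in `M` when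
`{(p, x) : p ∈ Icc a b, x ∈ U, H (p, x) = 0}` is compact; the projection `φ : X → P` is a subanalytic
mapping (its graph is semianalytic); Thm. 3.14 bounds the number of connected components of the fibres
`φ⁻¹(p) = {x ∈ U : H (p, x) = 0 ∧ G (p, x) = 0}` (resp. `≠ 0`) locally on `P`, hence uniformly on the
compact box; finiteness of each fibre is (F1) (the fibre of the compact set over `p` is compact).  (F3) is
Theorem 1 verbatim: `Z ∩ K = {x ∈ K : fderiv ℝ f x = 0}` for `K ⊆ D`; a finite-dimensional real normed space
is `E_N` after a linear isomorphism, which preserves analyticity, critical points and values.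
-/

namespace Literature.Geometry.Semianalytic

/-- **Bierstone–Milman 1988, Corollary 2.7 (2), for analytic sign sets with compact zero locus.**  For
`h, g` real-analytic on an open set `U` of a finite-dimensional real normed space such that
`{x ∈ U : h x = 0}` is compact, each of the sets `{x ∈ U : h x = 0 ∧ g x = 0}` and
`{x ∈ U : h x = 0 ∧ g x ≠ 0}` has finitely many connected components (the set of its
`connectedComponentIn`-components is finite).
-- TODO(general form): every relatively compact semianalytic subset of a real-analytic manifold has
-- finitely many connected components, each semianalytic (needs the notion `IsSemianalytic`).
[cite: BierstoneMilman1988, Cor 2.7 (2) (p. 13; doi:10.1007/bf02699126)] -/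
def BierstoneMilman1988_signSet_components_finite : Prop :=
  ∀ (E : Type) [NormedAddCommGroup E] [NormedSpace ℝ E] [FiniteDimensional ℝ E] (U : Set E) (h g : E → ℝ),
    IsOpen U → AnalyticOnNhd ℝ h U → AnalyticOnNhd ℝ g U → IsCompact {x | x ∈ U ∧ h x = 0} →
      (connectedComponentIn {x | x ∈ U ∧ h x = 0 ∧ g x = 0} '' {x | x ∈ U ∧ h x = 0 ∧ g x = 0}).Finite ∧
      (connectedComponentIn {x | x ∈ U ∧ h x = 0 ∧ g x ≠ 0} '' {x | x ∈ U ∧ h x = 0 ∧ g x ≠ 0}).Finite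

/-- **Bierstone–Milman 1988, Theorem 3.14, for analytic families of sign sets over a compact parameter
box** (fibrewise finiteness from Corollary 2.7 (2)).  For `H, G` real-analytic on `P × U` (`P ⊆ ℝᵐ` and
`U` open), a closed box `Icc a b ⊆ P`, and `{(p, x) : p ∈ Icc a b, x ∈ U, H (p, x) = 0}` compact, there is
`N` such that for every `p ∈ Icc a b` the fibres `{x ∈ U : H (p, x) = 0 ∧ G (p, x) = 0}` and
`{x ∈ U : H (p, x) = 0 ∧ G (p, x) ≠ 0}` have finitely many, and at most `N`, connected components.
-- TODO(general form): `X ⊆ M` relatively compact, `φ : X → N` a subanalytic mapping ⇒ the number of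
-- connected components of `φ⁻¹(y)` is bounded locally on `N` (needs `IsSubanalytic`).
[cite: BierstoneMilman1988, Thm 3.14 (p. 21; doi:10.1007/bf02699126)] -/
def BierstoneMilman1988_fibre_components_bounded : Prop :=
  ∀ (m : ℕ) (E : Type) [NormedAddCommGroup E] [NormedSpace ℝ E] [FiniteDimensional ℝ E]
    (P : Set (Fin m → ℝ)) (U : Set E) (a b : Fin m → ℝ) (H G : (Fin m → ℝ) × E → ℝ),
    IsOpen P → IsOpen U → Set.Icc a b ⊆ P → AnalyticOnNhd ℝ H (P ×ˢ U) → AnalyticOnNhd ℝ G (P ×ˢ U) →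
    IsCompact {q : (Fin m → ℝ) × E | q.1 ∈ Set.Icc a b ∧ q.2 ∈ U ∧ H q = 0} →
      ∃ N : ℕ, ∀ p ∈ Set.Icc a b,
        (connectedComponentIn {x | x ∈ U ∧ H (p, x) = 0 ∧ G (p, x) = 0} '' {x | x ∈ U ∧ H (p, x) = 0 ∧ G (p, x) = 0}).Finite ∧
        (connectedComponentIn {x | x ∈ U ∧ H (p, x) = 0 ∧ G (p, x) = 0} '' {x | x ∈ U ∧ H (p, x) = 0 ∧ G (p, x) = 0}).ncard ≤ N ∧
        (connectedComponentIn {x | x ∈ U ∧ H (p, x) = 0 ∧ G (p, x) ≠ 0} '' {x | x ∈ U ∧ H (p, x) = 0 ∧ G (p, x) ≠ 0}).Finite ∧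
        (connectedComponentIn {x | x ∈ U ∧ H (p, x) = 0 ∧ G (p, x) ≠ 0} '' {x | x ∈ U ∧ H (p, x) = 0 ∧ G (p, x) ≠ 0}).ncard ≤ N

/-- **Souček–Souček 1972, Theorem 1.**  A function real-analytic on an open set `D` of a
finite-dimensional real normed space takes only finitely many values on `{x ∈ K : fderiv ℝ f x = 0}` for
every compact `K ⊆ D` (hence countably many critical values on `D`).
[cite: SoucekSoucek1972, Thm 1 (p. 45; Comment. Math. Univ. Carolinae 13 (1972) 45–51)] -/
def SoucekSoucek1972_criticalValues_finite : Prop :=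
  ∀ (E : Type) [NormedAddCommGroup E] [NormedSpace ℝ E] [FiniteDimensional ℝ E] (D K : Set E) (f : E → ℝ),
    IsOpen D → AnalyticOnNhd ℝ f D → IsCompact K → K ⊆ D → (f '' {x | x ∈ K ∧ fderiv ℝ f x = 0}).Finite

end Literature.Geometry.Semianalytic
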